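/-
Copyright: the b2b-balaban cell (near-miss cell 7), T⁴-continuum fan-out; row NE7b swarm table S10, supplied by the
swarm seat `t4-ne7b-formalise-leaf-07`.  Released under the licence of the surrounding project.
-/
import Summits.QuantumFields.BalabanUV.T4Continuum.Support.HistorySocket

/-!
# Row NE7b, leaf S10: the history socket is MONOTONE IN THE SYMBOLIC CONSTANTS; free count margins; existence

Summits-side support leaf of the T⁴-continuum cell (rung (B)+1 on a FINITE torus only; NOT infinite volume, NOT the
mass gap, NOT the Clay statement; NOT a proof of the spine estimate NE7b).  Claim table
`t4/b2b-balaban-t4-ne7b-p1/LEAVES-NE7b.md` row S10 («P3b existence of dominating constants + the `price`∕`price′`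
fields of `HistorySocket.LiveHistories` from the domination»).  [folklore] real arithmetic and finite sums over the
lineage's OWN typed carrier (`T4PrintedShapeBanking.Consts`, `cost`, `credit`, `HistorySocket.shapeZ`,
`HistorySocket.LiveHistories`); nothing is quoted from print, nothing printed is asserted, no `def … : Prop` fact is
minted (trigger condition c1), no constant is specialised to a numeral (c2∕c6).

WHY.  The (P) junction of the COUNT route is stated at SYMBOLIC constants `C : Consts` (fields `price`∕`price'`:
the class price is dominated by the product of the live members' labelled shapes `shapeZ C …`), and the exit then
wants `ThresholdOK C L r β₀`, the infrared smallness at `irThresholdZ C …` and two RATE conditions on the bank rate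
`C.κ₁` — a parameter of the COUNT CARRIER, not of print.  The transcription (rows S1–S7, S9, the displayed reading
H3) fills the socket at ONE record `Cp` of print-shaped constants.  This leaf proves that nothing else is needed:
(§1) `C` REFINES `Cp` when it has the same discrete data (`n₁ q′ dC p₀`), no larger profile amplitude and quadratic
birth credit (`C.A₀ ≤ Cp.A₀`, `C.a·C.A₀² ≤ Cp.a·Cp.A₀²`), no smaller floor∕size constants (`Cp.E₂ ≤ C.E₂`,
`Cp.E₃ ≤ C.E₃`) — bank rate and margins `κ₁ E₀ Eb μ` FREE; (§2) along a refinement every per-event credit does not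
increase and every per-step cost does not decrease, entrywise; (§3) hence every labelled shape does not decrease and
the whole socket transfers, `LiveHistories Cp … → LiveHistories C …` (`price`∕`price'` by products of nonnegative
entrywise bounds; `consistent`∕`wf`∕`pending` because the windows `dictW R n₁` coincide); (§3b) a displayed
CLASS-LINEAR per-birth factor `e^{θ·Σ_{births}(d′+1)}` of the reading (lattice-animal count of the new regions,
resummation of the dead past) is absorbed by lowering the quadratic birth constant
(`PlacementBatch.credits_lowerA_add_le`), and `lowerA Cp θ` refines `Cp`; (§4) margins are RE-CHOSEN after the
transcription (`withMargins`), dominating constants with `ThresholdOK` EXIST under nonnegativity of `E₂ E₃`,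
`fatWait dC ≤ n₁`, positivity of `a A₀`, `1 ≤ L`, `0 ≤ β₀` and the cell's exponent condition `r·(q′+1) < p₀` (pure
arithmetic), and a bank rate meeting the exit's two rate conditions exists (`exists_rate_margin`).  §5 sanity.

USE (row S12).  Fill `LiveHistories` at the transcription's record `Cp` (at `lowerA Cp θ` when the displayed bound
carries `e^{θ·birthLin}`, via `price_le_prod_lowerA`), choose margins `κ₁ E₀ Eb μ` (`κ₁` by `exists_rate_margin`),
set `C := withMargins … κ₁ E₀ Eb μ`, and feed `liveHistories_of_refines (refines_withMargins _) … H` and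
`thresholdOK_withMargins …` to `HistorySocket.relWeightBound_of_liveHistories`.

HONEST DEPENDENCY (cell): continuum YM on T⁴ ⇐ BetaPertH ∧ nine spine estimates (0/9 proved); BetaPertH ⇐ (D1) ∧ (D4)
∧ CAP+tail.  This file changes none of it.
-/

open Finset
open Literature.MathematicalPhysics.QuantumFieldTheory.Balaban1983to89
open T4PersistenceDictionary T4PersistentHistoryCount T4BankedInduction T4PrintedShapeBanking T4PartnerMultiplicity
open Summit.QuantumFields.BalabanUV.T4Continuum.PlacementBatch
open Summit.QuantumFields.BalabanUV.T4Continuum.PartnerMultiplicityF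
open Summit.QuantumFields.BalabanUV.T4Continuum.Crowding
open Summit.QuantumFields.BalabanUV.T4Continuum.CountThresholdUniform
open Summit.QuantumFields.BalabanUV.T4Continuum.HistorySocket

namespace Summit.QuantumFields.BalabanUV.T4Continuum.HistoryConstantsExist

noncomputable section

/-! ## §1 Refinement of symbolic constants -/

/-- **`C` REFINES `Cp`**: same merger allowance, window power, connector class and profile exponent; profile amplitude
and quadratic birth constant no larger (so every CREDIT of `C` is at most that of `Cp`); floor and size constants no
smaller (so every COST of `C` is at least that of `Cp`).  The bank rate `κ₁` and the margins `E₀ Eb μ` are free.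
[folklore] -/
structure Refines (C Cp : T4PrintedShapeBanking.Consts) : Prop where
  /-- same merger allowance (the windows `dictW R n₁` coincide) -/
  n₁_eq : C.n₁ = Cp.n₁
  /-- same window power -/
  q'_eq : C.q' = Cp.q'
  /-- same connector class -/
  dC_eq : C.dC = Cp.dC
  /-- same profile exponent -/
  p₀_eq : C.p₀ = Cp.p₀
  /-- the profile amplitude of `C` is nonnegative … -/
  A₀_nonneg : 0 ≤ C.A₀
  /-- … and at most that of `Cp` -/
  A₀_le : C.A₀ ≤ Cp.A₀
  /-- the quadratic birth credit of `C` is at most that of `Cp` -/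
  aA_le : C.a * C.A₀ ^ 2 ≤ Cp.a * Cp.A₀ ^ 2
  /-- the floor constant of `C` is at least that of `Cp` -/
  E₂_le : Cp.E₂ ≤ C.E₂
  /-- the size constant of `C` is at least that of `Cp` -/
  E₃_le : Cp.E₃ ≤ C.E₃

/-- refinement is reflexive (for a nonnegative amplitude) [folklore] -/
theorem Refines.refl {C : T4PrintedShapeBanking.Consts} (hA : 0 ≤ C.A₀) : Refines C C :=
  ⟨rfl, rfl, rfl, rfl, hA, le_rfl, le_rfl, le_rfl, le_rfl⟩

/-- refinement is transitive [folklore] -/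
theorem Refines.trans {C C' Cp : T4PrintedShapeBanking.Consts} (h : Refines C C') (h' : Refines C' Cp) :
    Refines C Cp :=
  ⟨h.n₁_eq.trans h'.n₁_eq, h.q'_eq.trans h'.q'_eq, h.dC_eq.trans h'.dC_eq, h.p₀_eq.trans h'.p₀_eq, h.A₀_nonneg,
    h.A₀_le.trans h'.A₀_le, h.aA_le.trans h'.aA_le, h'.E₂_le.trans h.E₂_le, h'.E₃_le.trans h.E₃_le⟩

/-! ## §2 Entrywise: credits do not increase, costs do not decrease -/

section Tables

variable {C Cp : T4PrintedShapeBanking.Consts} (h : Refines C Cp)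
include h

/-- the windows coincide [folklore] -/
theorem dictW_eq (R : ℕ → ℕ) : dictW R C.n₁ = dictW R Cp.n₁ := by rw [h.n₁_eq]

/-- the floor does not decrease [folklore] -/
theorem floorK_le (K : ℕ) (R : ℕ → ℕ) (n : ℕ) : floorK Cp K R n ≤ floorK C K R n := by
  unfold floorK; rw [h.q'_eq]; split_ifs
  · exact mul_le_mul_of_nonneg_right h.E₂_le (by positivity)
  · exact le_rfl

/-- the size weights coincide [folklore] -/
theorem wt_eq (e : PEv) : wt C e = wt Cp e := by unfold wt; rw [h.dC_eq]

/-- the size epoch lengths coincide [folklore] -/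
theorem fw_eq (e : PEv) : fw C e = fw Cp e := by unfold fw; rw [h.dC_eq]

/-- the size epochs coincide [folklore] -/
theorem supp_eq (e : PEv) : supp C e = supp Cp e := by unfold supp; rw [fw_eq h]

/-- the decaying size cost does not decrease [folklore] -/
theorem sz_le (K : ℕ) (R : ℕ → ℕ) (e : PEv) (n : ℕ) : sz Cp K R e n ≤ sz C K R e n := by
  unfold sz
  rw [supp_eq h, wt_eq h, h.q'_eq]
  split_ifs
  · have hw : 0 ≤ wt Cp e := wt_nonneg Cp e
    have : 0 ≤ (R n : ℝ) ^ Cp.q' * wt Cp e * (1 / 2 : ℝ) ^ (n - e.step) := by positivity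
    simpa only [mul_assoc] using mul_le_mul_of_nonneg_right h.E₃_le this
  · exact le_rfl

/-- the window floor of an event does not decrease [folklore] -/
theorem wfloor_le (K : ℕ) (R : ℕ → ℕ) (p : ℕ) (e : PEv) (n : ℕ) : wfloor Cp K R p e n ≤ wfloor C K R p e n := by
  unfold wfloor; rw [dictW_eq h]; split_ifs
  · exact floorK_le h K R n
  · exact le_rfl

/-- **THE PER-STEP COST OF A STRUCTURE DOES NOT DECREASE** along a refinement. [folklore] -/
theorem cost_le (K : ℕ) (R : ℕ → ℕ) (G : Gen PEv) (n : ℕ) : cost Cp K R G n ≤ cost C K R G n := by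
  unfold cost; rw [dictW_eq h]
  exact sum_le_sum fun e _ => add_le_add (wfloor_le h K R _ e n) (sz_le h K R e n)

/-- **THE LIFE COST DOES NOT DECREASE** along a refinement (same windows, same life). [folklore] -/
theorem lifeCost_le (K : ℕ) (R : ℕ → ℕ) (G : Gen PEv) :
    lifeCost (dictW R Cp.n₁) (cost Cp K R) G ≤ lifeCost (dictW R C.n₁) (cost C K R) G := by
  unfold lifeCost; rw [dictW_eq h]
  exact sum_le_sum fun n _ => cost_le h K R G n

/-- **THE CREDIT OF AN EVENT DOES NOT INCREASE** along a refinement, at steps where the profile base `log g⁻²` is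
nonnegative (the event's step and its predecessor). [folklore] -/
theorem credit_le (g : ℕ → ℝ) (e : PEv) (hx : 0 ≤ Real.log ((g e.step) ^ 2)⁻¹)
    (hx' : 0 ≤ Real.log ((g (e.step - 1)) ^ 2)⁻¹) : credit C g e ≤ credit Cp g e := by
  unfold credit p0Profile
  rw [h.p₀_eq]
  set x := Real.log ((g e.step) ^ 2)⁻¹
  have hxp : 0 ≤ x ^ Cp.p₀ := pow_nonneg hx _
  split_ifs
  · -- birth: `a·(A₀ x^p)²·(d′+1) + 2·A₀ x^p`
    have h1 : C.a * (C.A₀ * x ^ Cp.p₀) ^ 2 * ((e.fat : ℝ) + 1) ≤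
        Cp.a * (Cp.A₀ * x ^ Cp.p₀) ^ 2 * ((e.fat : ℝ) + 1) := by
      have e1 : ∀ a A : ℝ, a * (A * x ^ Cp.p₀) ^ 2 * ((e.fat : ℝ) + 1) =
          (a * A ^ 2) * ((x ^ Cp.p₀) ^ 2 * ((e.fat : ℝ) + 1)) := fun a A => by ring
      rw [e1, e1]
      exact mul_le_mul_of_nonneg_right h.aA_le (by positivity)
    have h2 : 2 * (C.A₀ * x ^ Cp.p₀) ≤ 2 * (Cp.A₀ * x ^ Cp.p₀) :=
      mul_le_mul_of_nonneg_left (mul_le_mul_of_nonneg_right h.A₀_le hxp) zero_le_two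
    exact add_le_add h1 h2
  · -- renewal: `A₀ x'^p`
    exact mul_le_mul_of_nonneg_right h.A₀_le (pow_nonneg hx' _)
  · exact le_rfl

/-- **THE CREDITS OF A GENEALOGY DO NOT INCREASE** along a refinement, when the profile base is nonnegative at every
step up to the cutoff and the genealogy's events happen no later than the cutoff. [folklore] -/
theorem credits_le {K : ℕ} (g : ℕ → ℝ) (hx : ∀ s, s ≤ K → 0 ≤ Real.log ((g s) ^ 2)⁻¹) {G : Gen PEv}
    (hG : ∀ e ∈ G.events, PEv.step e ≤ K) : credits (credit C g) G ≤ credits (credit Cp g) G := by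
  unfold credits
  exact sum_le_sum fun e he =>
    credit_le h g e (hx _ (hG e he)) (hx _ ((Nat.sub_le _ _).trans (hG e he)))

omit h in
/-- `Consistent` reads the constants only through the merger allowance `n₁` (the windows). [folklore] -/
theorem consistent_iff_of_n₁_eq (hn : C.n₁ = Cp.n₁) (K : ℕ) (R : ℕ → ℕ) :
    ∀ G : Gen PEv, Consistent C K R G ↔ Consistent Cp K R G
  | Gen.born b j => by simp only [Consistent]
  | Gen.renew G e k => by
      simp only [Consistent, consistent_iff_of_n₁_eq hn K R G, hn]
  | Gen.merge X Y e => by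
      simp only [Consistent, consistent_iff_of_n₁_eq hn K R X, consistent_iff_of_n₁_eq hn K R Y, hn]

omit h in
/-- the zone∕partner prefactor of the labelled shape is nonnegative [folklore] -/
theorem prefactor_nonneg {Kz σ Λ' : ℝ} (hKz : 0 ≤ Kz) (hσ : 0 ≤ σ) (hΛ : 0 ≤ Λ') (p : ℝ) (G : Gen PEv) :
    0 ≤ Kz ^ (merges G).card * (∏ e ∈ merges G, Crowding.Q (wcnt G) σ e.step ^ p) * Λ' ^ partnerAges PEv.step G :=
  mul_nonneg (mul_nonneg (pow_nonneg hKz _)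
    (prod_nonneg fun _ he => Real.rpow_nonneg (zero_le_one.trans (one_le_Qw_of_mem hσ he)) _)) (pow_nonneg hΛ _)

/-- **THE LABELLED SHAPE DOES NOT DECREASE** along a refinement (zone∕partner prefactors untouched; raw price
`e^{−credits}·e^{+lifeCost}` monotone), for a genealogy whose events happen no later than the cutoff — in particular
for a consistent one. [folklore] -/
theorem shapeZ_le {Kz p σ Λ' : ℝ} (hKz : 0 ≤ Kz) (hσ : 0 ≤ σ) (hΛ : 0 ≤ Λ') (R : ℕ → ℕ → ℕ) (g : ℕ → ℕ → ℝ)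
    (K : ℕ) (hx : ∀ s, s ≤ K → 0 ≤ Real.log ((g K s) ^ 2)⁻¹) {G : Gen PEv} (hG : ∀ e ∈ G.events, PEv.step e ≤ K) :
    shapeZ Cp Kz p σ Λ' R g K G ≤ shapeZ C Kz p σ Λ' R g K G := by
  unfold shapeZ
  refine mul_le_mul_of_nonneg_left ?_ (prefactor_nonneg hKz hσ hΛ p G)
  exact mul_le_mul (Real.exp_le_exp.2 (neg_le_neg (credits_le h (g K) hx hG)))
    (Real.exp_le_exp.2 (lifeCost_le h K (R K) G)) (Real.exp_pos _).le (Real.exp_pos _).le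

end Tables

/-! ## §3 The socket transfers along a refinement -/

section Socket

variable {γ κ : Type*} {C Cp : T4PrintedShapeBanking.Consts} {Kz p σ Λ' l₀ : ℝ} {K₀ : ℕ} {R : ℕ → ℕ → ℕ}
  {g : ℕ → ℕ → ℝ} {Cell : ℕ → ℕ → Finset γ} {E B : ℕ → ℕ → Finset PEv} {jstar : ℕ → ℕ}
  {Bad' : ℕ → ℝ → Finset κ} {F Rf F' Rf' : ℕ → κ → ℝ} {live : ℕ → κ → Finset (Gen PEv)}
  {cellOf : ℕ → Gen PEv → γ}

/-- **THE PRODUCT STEP**: a class price dominated by the product of the members' shapes at `Cp` is dominated by the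
product at any refinement `C` (entrywise bounds of nonnegative factors). [folklore] -/
theorem price_le_prod_of_refines (h : Refines C Cp) (hKz : 1 ≤ Kz) (hσ : 0 ≤ σ) (hΛ : 0 ≤ Λ') (K : ℕ)
    (hx : ∀ s, s ≤ K → 0 ≤ Real.log ((g K s) ^ 2)⁻¹) {S : Finset (Gen PEv)}
    (hS : ∀ G ∈ S, Consistent Cp K (R K) G) {x : ℝ} (hle : x ≤ ∏ G ∈ S, shapeZ Cp Kz p σ Λ' R g K G) :
    x ≤ ∏ G ∈ S, shapeZ C Kz p σ Λ' R g K G :=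
  hle.trans (prod_le_prod (fun G _ => shapeZ_nonneg hKz hσ hΛ R g K G)
    fun G hG => shapeZ_le h (zero_le_one.trans hKz) hσ hΛ R g K hx (step_le_of_consistent (hS G hG)))

/-- **THE HISTORY SOCKET TRANSFERS ALONG A REFINEMENT.**  If the live histories fill the socket at the constants `Cp`
(the transcription's record), they fill it at every `C` refining `Cp`, provided the profile base `log g_{K,s}⁻²` is
nonnegative along the runs (the exit asks `≥ 1`) and `Kz ≥ 1`, `σ ≥ 0`, `Λ′ ≥ 0` (the exit asks these too).  The
fields `consistent`∕`wf`∕`pending` transfer because the windows `dictW R n₁` coincide; `price`∕`price'` by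
`price_le_prod_of_refines`; the remaining fields do not mention the constants. [folklore] -/
theorem liveHistories_of_refines (h : Refines C Cp) (hKz : 1 ≤ Kz) (hσ : 0 ≤ σ) (hΛ : 0 ≤ Λ')
    (hx : ∀ K, K₀ ≤ K → ∀ s, s ≤ K → 0 ≤ Real.log ((g K s) ^ 2)⁻¹)
    (H : LiveHistories Cp Kz p σ Λ' l₀ K₀ R g Cell E B jstar Bad' F Rf F' Rf' live cellOf) :
    LiveHistories C Kz p σ Λ' l₀ K₀ R g Cell E B jstar Bad' F Rf F' Rf' live cellOf where
  consistent K G hK hG := (consistent_iff_of_n₁_eq h.n₁_eq K (R K) G).2 (H.consistent K G hK hG)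
  wf K G hK hG := by rw [dictW_eq h]; exact H.wf K G hK hG
  pending K G hK hG := by rw [dictW_eq h]; exact H.pending K G hK hG
  cell_mem := H.cell_mem
  root_mem := H.root_mem
  events_sub := H.events_sub
  old := H.old
  slot_inj := H.slot_inj
  live_inj := H.live_inj
  price K t ht hK c hc :=
    price_le_prod_of_refines h hKz hσ hΛ K (hx K hK)
      (fun G hG => H.consistent K G hK ⟨t, ht, c, hc, hG⟩) (H.price K t ht hK c hc)
  price' K t ht hK c hc :=
    price_le_prod_of_refines h hKz hσ hΛ K (hx K hK)
      (fun G hG => H.consistent K G hK ⟨t, ht, c, hc, hG⟩) (H.price' K t ht hK c hc)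

end Socket

/-! ## §3b Absorbing a class-linear per-birth factor by lowering the quadratic birth constant -/

section Absorb

variable {Cp : T4PrintedShapeBanking.Consts} {Kz p σ Λ' : ℝ}

/-- **THE CLASS-LINEAR CONTENT OF A GENEALOGY**: `Σ_{births b of G} (d′(b) + 1)`. [folklore] -/
def birthLin (G : Gen PEv) : ℝ := ∑ e ∈ G.events.filter (fun e => e.kind = 0), ((e.fat : ℝ) + 1)

/-- the per-step costs do not read the quadratic birth constant [folklore] -/
theorem cost_lowerA (θ : ℝ) (K : ℕ) (R : ℕ → ℕ) : cost (lowerA Cp θ) K R = cost Cp K R := rfl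

/-- **A CLASS-LINEAR FACTOR `e^{θ·Σ(d′+1)}` IS ABSORBED BY LOWERING `a` BY `θ`**: with `θ ≥ 0` and the profile
`p₀(g_{K,s}) ≥ 1` at the birth steps of `G`, `shapeZ Cp … G · e^{θ·birthLin G} ≤ shapeZ (lowerA Cp θ) … G`
(`PlacementBatch.credits_lowerA_add_le`; the costs and the zone∕partner prefactors are unchanged).  This is how a
displayed per-birth entropy ∕ resummation factor of the reading enters the socket: at the record `lowerA Cp θ`.
[folklore] -/
theorem shapeZ_mul_exp_le_lowerA (hKz : 0 ≤ Kz) (hσ : 0 ≤ σ) (hΛ : 0 ≤ Λ') {θ : ℝ} (hθ : 0 ≤ θ) (R : ℕ → ℕ → ℕ)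
    (g : ℕ → ℕ → ℝ) (K : ℕ) {G : Gen PEv}
    (hP : ∀ e ∈ G.events, e.kind = 0 → 1 ≤ p0Profile Cp.A₀ Cp.p₀ (g K e.step)) :
    shapeZ Cp Kz p σ Λ' R g K G * Real.exp (θ * birthLin G) ≤ shapeZ (lowerA Cp θ) Kz p σ Λ' R g K G := by
  unfold shapeZ
  have hcr : -credits (credit Cp (g K)) G + θ * birthLin G ≤ -credits (credit (lowerA Cp θ) (g K)) G := by
    have h := credits_lowerA_add_le (C := Cp) (g := g K) hθ G hP
    unfold birthLin
    linarith
  have hlc : lifeCost (dictW (R K) (lowerA Cp θ).n₁) (cost (lowerA Cp θ) K (R K)) G =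
      lifeCost (dictW (R K) Cp.n₁) (cost Cp K (R K)) G := by
    rw [cost_lowerA, lowerA_n₁]
  rw [hlc, mul_assoc, mul_right_comm (Real.exp _), ← Real.exp_add]
  exact mul_le_mul_of_nonneg_left (mul_le_mul_of_nonneg_right (Real.exp_le_exp.2 hcr) (Real.exp_pos _).le)
    (prefactor_nonneg hKz hσ hΛ p G)

/-- **THE PRODUCT STEP WITH ABSORPTION**: a class price dominated by the product of the members' shapes at `Cp` TIMES
their class-linear factors `e^{θ·birthLin}` is dominated by the product of the shapes at `lowerA Cp θ`. [folklore] -/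
theorem price_le_prod_lowerA (hKz : 1 ≤ Kz) (hσ : 0 ≤ σ) (hΛ : 0 ≤ Λ') {θ : ℝ} (hθ : 0 ≤ θ) (R : ℕ → ℕ → ℕ)
    (g : ℕ → ℕ → ℝ) (K : ℕ) {S : Finset (Gen PEv)}
    (hP : ∀ G ∈ S, ∀ e ∈ G.events, e.kind = 0 → 1 ≤ p0Profile Cp.A₀ Cp.p₀ (g K e.step)) {x : ℝ}
    (hle : x ≤ ∏ G ∈ S, shapeZ Cp Kz p σ Λ' R g K G * Real.exp (θ * birthLin G)) :
    x ≤ ∏ G ∈ S, shapeZ (lowerA Cp θ) Kz p σ Λ' R g K G :=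
  hle.trans (prod_le_prod (fun G _ => mul_nonneg (shapeZ_nonneg hKz hσ hΛ R g K G) (Real.exp_pos _).le)
    fun G hG => shapeZ_mul_exp_le_lowerA (zero_le_one.trans hKz) hσ hΛ hθ R g K (hP G hG))

/-- lowering the quadratic birth constant by `θ ≥ 0` is a refinement (nonnegative amplitude) [folklore] -/
theorem refines_lowerA (hA : 0 ≤ Cp.A₀) {θ : ℝ} (hθ : 0 ≤ θ) : Refines (lowerA Cp θ) Cp :=
  ⟨rfl, rfl, rfl, rfl, hA, le_rfl, by
    rw [lowerA_a, lowerA_A₀]; exact mul_le_mul_of_nonneg_right (by linarith) (by positivity), le_rfl, le_rfl⟩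

end Absorb

/-! ## §4 Free margins, and the existence of dominating constants with `ThresholdOK` -/

section Exist

/-- **RE-CHOOSING THE COUNT MARGINS**: the record `Cp` with its bank rate and bank margins replaced by `κ₁ E₀ Eb μ`
(everything print-shaped kept). [folklore] -/
def withMargins (Cp : T4PrintedShapeBanking.Consts) (κ₁ E₀ Eb μ : ℝ) : T4PrintedShapeBanking.Consts :=
  { Cp with κ₁ := κ₁, E₀ := E₀, Eb := Eb, μ := μ }

variable (Cp : T4PrintedShapeBanking.Consts) (κ₁ E₀ Eb μ : ℝ)

/-- the re-margined record has bank rate `κ₁` [folklore] -/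
@[simp] theorem withMargins_κ₁ : (withMargins Cp κ₁ E₀ Eb μ).κ₁ = κ₁ := rfl
/-- … renewal∕merger margin `E₀` [folklore] -/
@[simp] theorem withMargins_E₀ : (withMargins Cp κ₁ E₀ Eb μ).E₀ = E₀ := rfl
/-- … birth margin base `Eb` [folklore] -/
@[simp] theorem withMargins_Eb : (withMargins Cp κ₁ E₀ Eb μ).Eb = Eb := rfl
/-- … fatness margin `μ` [folklore] -/
@[simp] theorem withMargins_μ : (withMargins Cp κ₁ E₀ Eb μ).μ = μ := rfl
/-- … and keeps the merger allowance [folklore] -/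
@[simp] theorem withMargins_n₁ : (withMargins Cp κ₁ E₀ Eb μ).n₁ = Cp.n₁ := rfl
/-- … the profile exponent [folklore] -/
@[simp] theorem withMargins_p₀ : (withMargins Cp κ₁ E₀ Eb μ).p₀ = Cp.p₀ := rfl

variable {Cp κ₁ E₀ Eb μ}

/-- **THE RE-MARGINED RECORD REFINES THE ORIGINAL** (nonnegative amplitude). [folklore] -/
theorem refines_withMargins (hA : 0 ≤ Cp.A₀) : Refines (withMargins Cp κ₁ E₀ Eb μ) Cp :=
  ⟨rfl, rfl, rfl, rfl, hA, le_rfl, le_rfl, le_rfl, le_rfl⟩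

/-- it is valid when the print-shaped part of `Cp` is (nonnegative floor∕size constants, connector epoch within the
merger allowance) and the new margins are nonnegative [folklore] -/
theorem valid_withMargins (hE₂ : 0 ≤ Cp.E₂) (hE₃ : 0 ≤ Cp.E₃) (hdC : fatWait Cp.dC ≤ Cp.n₁) (hκ : 0 ≤ κ₁)
    (hE₀ : 0 ≤ E₀) (hEb : 0 ≤ Eb) (hμ : 0 ≤ μ) : (withMargins Cp κ₁ E₀ Eb μ).Valid :=
  ⟨hE₂, hE₃, hκ, hE₀, hEb, hμ, hdC⟩

/-- **`ThresholdOK` FOR THE RE-MARGINED RECORD**: add positivity of `a`, `A₀`, block size `L ≥ 1`, `β₀ ≥ 0` and the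
exponent condition `r·(q′+1) < p₀` (the cell's (X7); print's constants ledger asks `p₀ > (d+2)·r₀` at `q′ = d+1`).
[folklore] -/
theorem thresholdOK_withMargins {L r : ℕ} {β₀ : ℝ} (hE₂ : 0 ≤ Cp.E₂) (hE₃ : 0 ≤ Cp.E₃)
    (hdC : fatWait Cp.dC ≤ Cp.n₁) (ha : 0 < Cp.a) (hA : 0 < Cp.A₀) (hL : 1 ≤ L) (hβ : 0 ≤ β₀)
    (hrq : r * (Cp.q' + 1) < Cp.p₀) (hκ : 0 ≤ κ₁) (hE₀ : 0 ≤ E₀) (hEb : 0 ≤ Eb) (hμ : 0 ≤ μ) :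
    ThresholdOK (withMargins Cp κ₁ E₀ Eb μ) L r β₀ :=
  ⟨valid_withMargins hE₂ hE₃ hdC hκ hE₀ hEb hμ, ha, hA, hL, hβ, hrq⟩

/-- **EXISTENCE OF DOMINATING CONSTANTS** (row S10, P3b): for every record `Cp` of print-shaped constants
(`0 ≤ E₂ E₃`, `fatWait dC ≤ n₁`, `0 < a A₀`), every `L ≥ 1`, `β₀ ≥ 0`, exponents with `r·(q′+1) < p₀`, and EVERY
choice of nonnegative count margins `κ₁ E₀ Eb μ`, there is a record `C` with `ThresholdOK C L r β₀`, refining `Cp`,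
carrying exactly those margins. [folklore] -/
theorem exists_thresholdOK_refines (Cp : T4PrintedShapeBanking.Consts) {L r : ℕ} {β₀ : ℝ} (hE₂ : 0 ≤ Cp.E₂)
    (hE₃ : 0 ≤ Cp.E₃) (hdC : fatWait Cp.dC ≤ Cp.n₁) (ha : 0 < Cp.a) (hA : 0 < Cp.A₀) (hL : 1 ≤ L) (hβ : 0 ≤ β₀)
    (hrq : r * (Cp.q' + 1) < Cp.p₀) {κ₁ E₀ Eb μ : ℝ} (hκ : 0 ≤ κ₁) (hE₀ : 0 ≤ E₀) (hEb : 0 ≤ Eb) (hμ : 0 ≤ μ) :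
    ∃ C : T4PrintedShapeBanking.Consts, ThresholdOK C L r β₀ ∧ Refines C Cp ∧
      C.κ₁ = κ₁ ∧ C.E₀ = E₀ ∧ C.Eb = Eb ∧ C.μ = μ :=
  ⟨withMargins Cp κ₁ E₀ Eb μ, thresholdOK_withMargins hE₂ hE₃ hdC ha hA hL hβ hrq hκ hE₀ hEb hμ,
    refines_withMargins hA.le, rfl, rfl, rfl, rfl⟩

/-- `Λ·e^{y} < 1` once `y ≤ −(Λ + 1)` (`Λ ≥ 0`), since `Λ < Λ + 2 ≤ e^{Λ+1}`. [folklore] -/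
theorem mul_exp_lt_one_of_le {Λ y : ℝ} (hΛ : 0 ≤ Λ) (hy : y ≤ -(Λ + 1)) : Λ * Real.exp y < 1 := by
  have h1 : Λ * Real.exp y ≤ Λ * Real.exp (-(Λ + 1)) := mul_le_mul_of_nonneg_left (Real.exp_le_exp.2 hy) hΛ
  have h2 : Λ + 1 + 1 ≤ Real.exp (Λ + 1) := Real.add_one_le_exp _
  have h3 : Λ * Real.exp (-(Λ + 1)) < 1 := by
    rw [Real.exp_neg, ← div_eq_mul_inv, div_lt_one (Real.exp_pos _)]; linarith
  exact h1.trans_lt h3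

/-- **THE TWO RATE CONDITIONS OF THE EXIT ARE MET BY A LARGE BANK RATE**: for `Λ, Λ′ ≥ 0` and any `η̄`, `ε` there is
`κ₁ ≥ 0` with `Λ·e^{η̄ − κ₁} < 1` and `Λ′·e^{ε}·e^{−κ₁} ≤ 1` (so the free margin `κ₁` of `exists_thresholdOK_refines`
can always be taken admissible for `HistorySocket.relWeightBound_of_liveHistories`). [folklore] -/
theorem exists_rate_margin (Λ Λ' ηbar ε : ℝ) (hΛ : 0 ≤ Λ) (hΛ' : 0 ≤ Λ') :
    ∃ κ₁ : ℝ, 0 ≤ κ₁ ∧ Λ * Real.exp (ηbar - κ₁) < 1 ∧ Λ' * Real.exp ε * Real.exp (-κ₁) ≤ 1 := by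
  -- take `κ₁ = |η̄| + |ε| + Λ + Λ′ + 1`
  refine ⟨|ηbar| + |ε| + Λ + Λ' + 1, by positivity, mul_exp_lt_one_of_le hΛ ?_, ?_⟩
  · linarith [le_abs_self ηbar, abs_nonneg ε]
  · rw [mul_assoc, ← Real.exp_add]
    exact (mul_exp_lt_one_of_le hΛ' (by linarith [le_abs_self ε, abs_nonneg ηbar])).le

end Exist

/-! ## §5 Sanity -/

namespace Sanity

/-- refinement is neither vacuous nor the identity: the cross-read's toy record `C₀` of `T4PrintedShapeBanking`
re-margined with bank rate `5` refines `C₀` and differs from it; a strictly larger floor constant refines too, and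
the floor then strictly INCREASES on a performed step (the monotonicity of §2 in the right direction). [folklore] -/
example : Refines (withMargins XreadC4.C₀ 5 0 0 0) XreadC4.C₀ ∧ (withMargins XreadC4.C₀ 5 0 0 0).κ₁ ≠ XreadC4.C₀.κ₁ ∧
    Refines { XreadC4.C₀ with E₂ := XreadC4.C₀.E₂ + 1 } XreadC4.C₀ ∧
    floorK XreadC4.C₀ 10 (fun _ => 2) 0 < floorK { XreadC4.C₀ with E₂ := XreadC4.C₀.E₂ + 1 } 10 (fun _ => 2) 0 := by
  refine ⟨refines_withMargins (by simp [XreadC4.C₀]), by simp [XreadC4.C₀],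
    ⟨rfl, rfl, rfl, rfl, by simp [XreadC4.C₀], le_rfl, le_rfl, by simp, le_rfl⟩, by simp [floorK, XreadC4.C₀]⟩

end Sanity

end

end Summit.QuantumFields.BalabanUV.T4Continuum.HistoryConstantsExist
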